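import Literature.Analysis.FluidPDE.OseenZoomCovariance
import Literature.Analysis.FluidPDE.OseenMildSlabChain
import Literature.Analysis.FluidPDE.TypeIAncientMild
import Literature.Analysis.FluidPDE.BoundedWeakIsometry
import Literature.Analysis.FluidPDE.SelfSimilarProofs
import Literature.Analysis.FluidPDE.RdssPeriodConcatenation
import HarnessLib

/-!
# Route `PumpContinuation`, crux `EulerProximatePump` (stmt-NavierStokesRegularity-18302), line
  `SketchIdeator2` — tools for stub `stub_dssTruncationBridgeTypeI`, I: the Type-I rate of the
  concatenation of per-period Oseen-mild solutions along the rotated self-similar zoom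

The tree's `Literature.Analysis.FluidPDE.exists_concatenation_of_periodic_slabs`
(`Literature/Analysis/FluidPDE/RdssPeriodConcatenation.lean`) concatenates model-period solutions
`f_k` on `[−1, −c⁻²] × E`, linked by the junction condition `f_{k+1}(−1) = 𝒮⁻¹(f_k(−c⁻²))`, into one
Oseen-mild solution `v(t, x) = cᵏ(Rᵏ)⁻¹ f_k(c^{2k}(t − 1), cᵏRᵏx)` on the physical slabs
`t ∈ [1 − c^{−2k}, 1 − c^{−2k−2}]`, and records that `v` is bounded on every `[0, 1 − δ]` and unbounded
at `(1, 0)`.  The concatenated field is hidden behind an existential, so the one extra piece of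
information needed downstream — the **Type-I rate** — has to be proved together with the rest:
if the model solutions are bounded by one constant `M` UNIFORMLY in `k`, then on the `k`-th slab
`‖v(t, x)‖ ≤ cᵏ M ≤ M / √(1 − t)`, because `1 − t ≤ c^{−2k}` there.  This file re-proves the
concatenation theorem verbatim (same construction, same tree lemmas) with that uniform hypothesis and
the extra conclusion `∀ t ∈ [0, 1), ∀ x, ‖v(t, x)‖ ≤ M / √(1 − t)` (`exists_concatenation_of_periodic_slabs_typeI`).
It is consumed by the Type-I period package and the proof of `DssTruncationBridgeTypeI`
(stmt-NavierStokesRegularity-14478 = stub `stub_dssTruncationBridgeTypeI` of this line) in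
`Theorems/PumpContinuationEulerProximatePumpTruncationBridgeTypeI.lean`.

The file closes with the registered tools stub `stub_typeIConcatenationTools` (the `ℝ³` instance).

## References

* Z. Bradshaw, T.-P. Tsai, Comm. PDE 42 (2017), §1 (RDSS fields, the period map modulo rotation).
  [BradshawTsai2017CPDE]
* G. Koch, N. Nadirashvili, G. Seregin, V. Šverák, Acta Math. 203 (2009), §1 (1.2), §4 (4.4)
  (Type-I bound `|u| ≤ C/√(T − t)` and its scaling). [KochNadirashviliSereginSverak2009]
-/

noncomputable section

open MeasureTheory Set Function Filter
open _root_.Topology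

set_option linter.dupNamespace false

namespace Summit.NavierStokesRegularity.NavierStokesRegularity.Theorems

namespace PumpContinuationEulerProximatePump

open Literature.Analysis Literature.Analysis.FluidPDE

variable {E : Type*} [NormedAddCommGroup E] [InnerProductSpace ℝ E] [FiniteDimensional ℝ E]
  [MeasurableSpace E] [BorelSpace E]

/-- **Concatenation of per-period Oseen-mild solutions, with the Type-I rate** (the period-map
picture of rotated discretely self-similar dynamics; Bradshaw–Tsai 2017, §1; Chae–Wolf 2017,
Def. 1.1; the rate is the scaling count of Koch–Nadirashvili–Seregin–Šverák 2009, (1.2)).  Let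
`c > 1`, `R` a linear isometry, and `f_k` (`k ∈ ℕ`) fields on the model period `[−1, −c⁻²] × E`, each
jointly continuous, weakly divergence free and Oseen-mild between all pairs of model times, bounded
by ONE constant `M` uniformly in `k`, linked by the junction condition
`f_{k+1}(−1) = 𝒮⁻¹(f_k(−c⁻²))`, `𝒮⁻¹h = c⁻¹ R h(c⁻¹R⁻¹·)`, and with `‖f_k(−1, y₀)‖ ≥ m > 0`.  Then the
concatenation `v(t, x) = cᵏ(Rᵏ)⁻¹f_k(c^{2k}(t − 1), cᵏRᵏx)` on `t ∈ [1 − c^{−2k}, 1 − c^{−2k−2}]` is an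
Oseen-mild solution on `[0, 1)` with datum `f_0(−1)`: jointly continuous, weakly divergence free,
satisfying the Oseen equation between all pairs `0 ≤ s < t < 1`, bounded on every `[0, 1 − δ]`,
unbounded as `(t, x) → (1, 0)`, and **Type I**: `‖v(t, x)‖ ≤ M / √(1 − t)` for `0 ≤ t < 1`
(`cᵏ ≤ (1 − t)^{−1/2}` on the `k`-th slab).  Same construction as the tree's
`exists_concatenation_of_periodic_slabs`, re-proved because that theorem hides `v`. [cite: BradshawTsai2017CPDE, §1 (rotated discretely self-similar fields; the period map modulo rotation)] -/
theorem exists_concatenation_of_periodic_slabs_typeI {c : ℝ} (hc : 1 < c) (R : E ≃ₗᵢ[ℝ] E)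
    (f : ℕ → ℝ → E → E)
    (hcont : ∀ k, ContinuousOn (uncurry (f k)) (Icc (-1) (-(c ^ 2)⁻¹) ×ˢ univ))
    (M : ℝ) (hbdM : ∀ k, ∀ t ∈ Icc (-1 : ℝ) (-(c ^ 2)⁻¹), ∀ x, ‖f k t x‖ ≤ M)
    (hdiv : ∀ k, ∀ t ∈ Icc (-1 : ℝ) (-(c ^ 2)⁻¹), IsWeaklyDivFree (f k t))
    (hoseen : ∀ k, ∀ s t : ℝ, -1 ≤ s → s < t → t ≤ -(c ^ 2)⁻¹ → ∀ x,
      f k t x = heatFlow (f k s) (t - s) x - oseenDuhamel 1 s (f k) (f k) t x)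
    (hjump : ∀ k y, f (k + 1) (-1) y = c⁻¹ • R (f k (-(c ^ 2)⁻¹) (c⁻¹ • R.symm y)))
    (y₀ : E) {m : ℝ} (hm : 0 < m) (hmk : ∀ k, m ≤ ‖f k (-1) y₀‖) :
    ∃ v : ℝ → E → E, v 0 = f 0 (-1) ∧
      ContinuousOn (uncurry v) (Ico 0 1 ×ˢ univ) ∧
      (∀ t ∈ Ico (0 : ℝ) 1, IsWeaklyDivFree (v t)) ∧
      (∀ s t : ℝ, 0 ≤ s → s < t → t < 1 → ∀ x,
        v t x = heatFlow (v s) (t - s) x - oseenDuhamel 1 s v v t x) ∧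
      (∀ δ : ℝ, 0 < δ → IsBoundedOn (Icc 0 (1 - δ)) v) ∧
      (∀ K δ : ℝ, 0 < δ → ∃ t ∈ Ico (0 : ℝ) 1, ∃ x : E, 1 - δ < t ∧ ‖x‖ < δ ∧ K < ‖v t x‖) ∧
      (∀ t ∈ Ico (0 : ℝ) 1, ∀ x, ‖v t x‖ ≤ M / Real.sqrt (1 - t)) := by
  classical
  have hbd : ∀ k, ∃ M : ℝ, ∀ t ∈ Icc (-1 : ℝ) (-(c ^ 2)⁻¹), ∀ x, ‖f k t x‖ ≤ M :=
    fun k => ⟨M, hbdM k⟩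
  have hc0 : 0 < c := one_pos.trans hc
  have hc2 : 0 < c ^ 2 := by positivity
  set q : ℝ := (c ^ 2)⁻¹ with hq
  have hq0 : 0 < q := inv_pos.2 hc2
  have hq1 : q < 1 := inv_lt_one_of_one_lt₀ (by nlinarith)
  have hcq : c ^ 2 * q = 1 := mul_inv_cancel₀ hc2.ne'
  have hβ : ∀ k : ℕ, (c ^ k) ^ 2 = (c ^ 2) ^ k := fun k => by rw [← pow_mul, ← pow_mul, mul_comm]
  have hβq : ∀ k : ℕ, (c ^ 2) ^ k * q ^ k = 1 := fun k => by rw [← mul_pow, hcq, one_pow]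
  -- the slab ends `T k = 1 - q^k`
  set T : ℕ → ℝ := fun k => 1 - q ^ k with hT
  have hT0 : T 0 = 0 := by simp [hT]
  have hTlt : ∀ k, T k < T (k + 1) := fun k => by
    simp only [hT]
    have h : q ^ k * q < q ^ k := mul_lt_of_lt_one_right (pow_pos hq0 k) hq1
    rw [pow_succ]
    linarith
  have hTmono : Monotone T := monotone_nat_of_le_succ fun k => (hTlt k).le
  have hT1 : ∀ k, T k < 1 := fun k => by simp only [hT]; linarith [pow_pos hq0 k]
  have hTlim : ∀ t < 1, ∃ n, t < T n := fun t ht => by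
    obtain ⟨n, hn⟩ := exists_pow_lt_of_lt_one (sub_pos.2 ht) hq1
    exact ⟨n, by simp only [hT]; linarith⟩
  have hstart : ∀ k : ℕ, (c ^ k) ^ 2 * (T k - 1) = -1 := fun k => by
    rw [hβ k]; simp only [hT]
    rw [show (1 : ℝ) - q ^ k - 1 = -(q ^ k) by ring, mul_neg, hβq]
  have hend : ∀ k : ℕ, (c ^ k) ^ 2 * (T (k + 1) - 1) = -q := fun k => by
    rw [hβ k]; simp only [hT]
    rw [show (1 : ℝ) - q ^ (k + 1) - 1 = -(q ^ k * q) by ring, mul_neg, ← mul_assoc, hβq, one_mul]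
  have hmodel : ∀ k, ∀ t ∈ Icc (T k) (T (k + 1)), (c ^ k) ^ 2 * (t - 1) ∈ Icc (-1 : ℝ) (-q) := by
    intro k t ht
    have hpos : 0 ≤ (c ^ k) ^ 2 := by positivity
    refine ⟨?_, ?_⟩
    · rw [← hstart k]; exact mul_le_mul_of_nonneg_left (by linarith [ht.1]) hpos
    · rw [← hend k]; exact mul_le_mul_of_nonneg_left (by linarith [ht.2]) hpos
  -- the pieces
  set P : ℕ → ℝ → E → E := fun k t x =>
    c ^ k • (R ^ k).symm (f k ((c ^ k) ^ 2 * (t - 1)) (c ^ k • (R ^ k) x)) with hP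
  have hjunction : ∀ k x, P (k + 1) (T (k + 1)) x = P k (T (k + 1)) x := by
    intro k x
    simp only [hP]
    rw [hstart (k + 1), hend k, hjump]
    have e3 : c⁻¹ • R.symm (c ^ (k + 1) • (R ^ (k + 1)) x) = c ^ k • (R ^ k) x := by
      rw [LinearIsometryEquiv.map_smul, smul_smul, linearIsometryEquiv_pow_succ_apply,
        LinearIsometryEquiv.symm_apply_apply, pow_succ', ← mul_assoc, inv_mul_cancel₀ hc0.ne',
        one_mul]
    rw [e3, LinearIsometryEquiv.map_smul, linearIsometryEquiv_pow_succ_symm_apply, smul_smul,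
      pow_succ, mul_assoc, mul_inv_cancel₀ hc0.ne', mul_one]
  -- the concatenated field
  have hex : ∀ t < (1 : ℝ), ∃ k, t < T (k + 1) := fun t ht =>
    (hTlim t ht).imp fun n hn => hn.trans_le (hTmono (Nat.le_succ n))
  let idx : ℝ → ℕ := fun t => if h : t < 1 then Nat.find (hex t h) else 0
  let v : ℝ → E → E := fun t x => P (idx t) t x
  have hidx : ∀ k, ∀ t ∈ Ico (T k) (T (k + 1)), idx t = k := by
    intro k t ht
    have ht1 : t < 1 := ht.2.trans (hT1 _)
    simp only [idx, dif_pos ht1]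
    rw [Nat.find_eq_iff]
    refine ⟨ht.2, fun j hj hlt => ?_⟩
    exact absurd (hlt.trans_le ((hTmono (Nat.succ_le_of_lt hj)).trans ht.1)) (lt_irrefl t)
  have hv_eq : ∀ k, ∀ t ∈ Icc (T k) (T (k + 1)), ∀ x, v t x = P k t x := by
    intro k t ht x
    rcases ht.2.lt_or_eq with hlt | heq
    · simp only [v, hidx k t ⟨ht.1, hlt⟩]
    · rw [heq]
      simp only [v, hidx (k + 1) (T (k + 1)) ⟨le_rfl, hTlt (k + 1)⟩]
      exact hjunction k x
  have hcover : ∀ t, 0 ≤ t → t < 1 → ∃ k, t ∈ Ico (T k) (T (k + 1)) := by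
    intro t ht0 ht1
    have hex' : ∃ n, t < T n := hTlim t ht1
    have hn₀ : t < T (Nat.find hex') := Nat.find_spec hex'
    have hpos : Nat.find hex' ≠ 0 := fun h => by rw [h, hT0] at hn₀; linarith
    obtain ⟨k, hk⟩ := Nat.exists_eq_add_one_of_ne_zero hpos
    refine ⟨k, ⟨?_, by rw [hk] at hn₀; exact hn₀⟩⟩
    by_contra hlt
    exact Nat.find_min hex' (show k < Nat.find hex' by omega) (not_le.1 hlt)
  -- per-slab properties of `v`
  have hvcont : ∀ k, ContinuousOn (uncurry v) (Icc (T k) (T (k + 1)) ×ˢ univ) := fun k =>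
    (continuousOn_zoom_shift (c ^ k) (R ^ k) (hcont k) (hmodel k)).congr
      fun p hp => hv_eq k p.1 hp.1 p.2
  have hvbd : ∀ k, ∃ M : ℝ, ∀ τ ∈ Icc (T k) (T (k + 1)), ∀ y, ‖v τ y‖ ≤ M := by
    intro k
    obtain ⟨M, hM⟩ := hbd k
    refine ⟨c ^ k * M, fun τ hτ y => ?_⟩
    rw [hv_eq k τ hτ y]
    simp only [hP]
    rw [norm_smul, Real.norm_of_nonneg (pow_pos hc0 k).le, LinearIsometryEquiv.norm_map]
    exact mul_le_mul_of_nonneg_left (hM _ (hmodel k τ hτ) _) (pow_pos hc0 k).le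
  have hvslab : ∀ k, ∀ s t : ℝ, T k ≤ s → s < t → t ≤ T (k + 1) → ∀ x,
      v t x = heatFlow (v s) (t - s) x - oseenDuhamel 1 s v v t x := by
    intro k s t hs hst ht x
    have hsI : s ∈ Icc (T k) (T (k + 1)) := ⟨hs, hst.le.trans ht⟩
    have htI : t ∈ Icc (T k) (T (k + 1)) := ⟨hs.trans hst.le, ht⟩
    have hvs : v s = P k s := funext fun y => hv_eq k s hsI y
    have hB : oseenDuhamel 1 s v v t x = oseenDuhamel 1 s (P k) (P k) t x :=
      oseenDuhamel_congr_ae_slice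
        (fun τ hτ => Eventually.of_forall fun y =>
          hv_eq k τ ⟨hs.trans hτ.1.le, hτ.2.le.trans ht⟩ y)
        (fun τ hτ => Eventually.of_forall fun y =>
          hv_eq k τ ⟨hs.trans hτ.1.le, hτ.2.le.trans ht⟩ y) x
    rw [hv_eq k t htI x, hvs, hB]
    exact oseen_zoom_shift (pow_pos hc0 k) (R ^ k) (hoseen k) (hmodel k s hsI).1 hst
      (hmodel k t htI).2 x
  refine ⟨v, ?_, ?_, ?_, ?_, ?_, ?_, ?_⟩
  · -- the datum
    funext x
    have h := hv_eq 0 (T 0) ⟨le_rfl, (hTlt 0).le⟩ x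
    rw [hT0] at h
    rw [h]
    simp only [hP, pow_zero, one_smul, one_pow, one_mul, zero_sub, ← LinearIsometryEquiv.inv_def,
      inv_one, LinearIsometryEquiv.coe_one, id_eq]
  · -- joint continuity on `[0, 1) × E`
    have h := continuousOn_uncurry_Ico_of_chain hTmono hvcont (L := 1) hTlim
    rwa [hT0] at h
  · -- weakly divergence free
    intro t ht
    obtain ⟨k, hk⟩ := hcover t ht.1 ht.2
    have hvt : v t = P k t := funext fun y => hv_eq k t (Ico_subset_Icc_self hk) y
    rw [hvt]
    exact isWeaklyDivFree_zoom_in (hdiv k _ (hmodel k t (Ico_subset_Icc_self hk))) (pow_pos hc0 k)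
      (R ^ k)
  · -- the Oseen equation between all pairs
    have h := oseenMild_of_chain hTmono hvcont hvbd hvslab (L := 1) hTlim
    rw [hT0] at h
    exact h
  · -- bounded on `[0, 1 - δ]`
    intro δ hδ
    obtain ⟨n, hn⟩ := hTlim (1 - δ) (by linarith)
    obtain ⟨M, hM⟩ := exists_bound_Icc_of_chain hTmono hvbd hn.le
    rw [hT0] at hM
    exact ⟨M, hM⟩
  · -- unbounded as `(t, x) → (1, 0)`
    intro K δ hδ
    have h1 : Tendsto (fun k : ℕ => c ^ k) atTop atTop := tendsto_pow_atTop_atTop_of_one_lt hc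
    have h2 : Tendsto (fun k : ℕ => q ^ k) atTop (𝓝 0) :=
      tendsto_pow_atTop_nhds_zero_of_lt_one hq0.le hq1
    have h3 : Tendsto (fun k : ℕ => (c ^ k)⁻¹) atTop (𝓝 0) := tendsto_inv_atTop_zero.comp h1
    have hy : 0 < δ / (‖y₀‖ + 1) := by positivity
    obtain ⟨k, hk1, hk2, hk3⟩ := ((h1.eventually_gt_atTop (K / m)).and
      ((h2.eventually (gt_mem_nhds hδ)).and (h3.eventually (gt_mem_nhds hy)))).exists
    have hck : 0 < c ^ k := pow_pos hc0 k
    refine ⟨T k, ⟨by rw [← hT0]; exact hTmono (Nat.zero_le k), hT1 k⟩,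
      (c ^ k)⁻¹ • (R ^ k).symm y₀, ?_, ?_, ?_⟩
    · simp only [hT]; linarith
    · rw [norm_smul, norm_inv, Real.norm_of_nonneg hck.le, LinearIsometryEquiv.norm_map]
      calc (c ^ k)⁻¹ * ‖y₀‖ ≤ (c ^ k)⁻¹ * (‖y₀‖ + 1) := by gcongr; linarith
        _ < δ / (‖y₀‖ + 1) * (‖y₀‖ + 1) := by gcongr
        _ = δ := div_mul_cancel₀ δ (by positivity)
    · rw [hv_eq k (T k) ⟨le_rfl, (hTlt k).le⟩]
      simp only [hP]
      rw [hstart k, LinearIsometryEquiv.map_smul, smul_smul, mul_inv_cancel₀ hck.ne', one_smul,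
        LinearIsometryEquiv.apply_symm_apply, norm_smul, Real.norm_of_nonneg hck.le,
        LinearIsometryEquiv.norm_map]
      have hK : K < c ^ k * m := by
        have := (div_lt_iff₀ hm).1 hk1
        linarith
      exact hK.trans_le (mul_le_mul_of_nonneg_left (hmk k) hck.le)
  · -- the Type-I rate: on the `k`-th slab `1 - t ≤ q^k = (cᵏ)⁻²`, so `cᵏ ≤ (1 - t)^{-1/2}`
    intro t ht x
    obtain ⟨k, hk⟩ := hcover t ht.1 ht.2
    have hck : 0 < c ^ k := pow_pos hc0 k
    have h1t : 0 < 1 - t := sub_pos.2 ht.2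
    have hM0 : 0 ≤ M :=
      (norm_nonneg _).trans (hbdM k _ (hmodel k t (Ico_subset_Icc_self hk)) (c ^ k • (R ^ k) x))
    have hle : 1 - t ≤ ((c ^ k) ^ 2)⁻¹ := by
      have h1 : 1 - t ≤ q ^ k := by
        have h2 := hk.1
        simp only [hT] at h2
        linarith
      have h3 : q ^ k = ((c ^ k) ^ 2)⁻¹ := by
        rw [hβ k, hq, inv_pow]
      rwa [h3] at h1
    have hsqrt : Real.sqrt (1 - t) ≤ (c ^ k)⁻¹ :=
      calc Real.sqrt (1 - t) ≤ Real.sqrt (((c ^ k) ^ 2)⁻¹) := Real.sqrt_le_sqrt hle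
        _ = (c ^ k)⁻¹ := by rw [Real.sqrt_inv, Real.sqrt_sq hck.le]
    rw [hv_eq k t (Ico_subset_Icc_self hk) x]
    simp only [hP]
    rw [norm_smul, Real.norm_of_nonneg hck.le, LinearIsometryEquiv.norm_map,
      le_div_iff₀ (Real.sqrt_pos.2 h1t)]
    calc c ^ k * ‖f k ((c ^ k) ^ 2 * (t - 1)) (c ^ k • (R ^ k) x)‖ * Real.sqrt (1 - t)
        ≤ c ^ k * M * (c ^ k)⁻¹ := by
          refine mul_le_mul ?_ hsqrt (Real.sqrt_nonneg _) (mul_nonneg hck.le hM0)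
          exact mul_le_mul_of_nonneg_left
            (hbdM k _ (hmodel k t (Ico_subset_Icc_self hk)) _) hck.le
      _ = M := by
          field_simp

/-- **Registered tools stub `stub_typeIConcatenationTools`** (line `SketchIdeator2`, crux
`EulerProximatePump`, stmt-NavierStokesRegularity-18302): the `ℝ³` instance of
`exists_concatenation_of_periodic_slabs_typeI`, registered with
`ledger workitem stub-add stmt-NavierStokesRegularity-18302 --name stub_typeIConcatenationTools`. [cite: BradshawTsai2017CPDE, §1 (rotated discretely self-similar fields; the period map modulo rotation)] -/
theorem stub_typeIConcatenationTools :
    ∀ (c : ℝ), 1 < c → ∀ (R : EuclideanSpace ℝ (Fin 3) ≃ₗᵢ[ℝ] EuclideanSpace ℝ (Fin 3))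
      (f : ℕ → ℝ → EuclideanSpace ℝ (Fin 3) → EuclideanSpace ℝ (Fin 3)),
      (∀ k, ContinuousOn (Function.uncurry (f k)) (Set.Icc (-1) (-(c ^ 2)⁻¹) ×ˢ Set.univ)) →
      ∀ (M : ℝ), (∀ k, ∀ t ∈ Set.Icc (-1 : ℝ) (-(c ^ 2)⁻¹), ∀ x, ‖f k t x‖ ≤ M) →
      (∀ k, ∀ t ∈ Set.Icc (-1 : ℝ) (-(c ^ 2)⁻¹), Literature.Analysis.FluidPDE.IsWeaklyDivFree (f k t)) →
      (∀ k, ∀ s t : ℝ, -1 ≤ s → s < t → t ≤ -(c ^ 2)⁻¹ → ∀ x,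
        f k t x = Literature.Analysis.FluidPDE.heatFlow (f k s) (t - s) x -
          Literature.Analysis.FluidPDE.oseenDuhamel 1 s (f k) (f k) t x) →
      (∀ k y, f (k + 1) (-1) y = c⁻¹ • R (f k (-(c ^ 2)⁻¹) (c⁻¹ • R.symm y))) →
      ∀ (y₀ : EuclideanSpace ℝ (Fin 3)) (m : ℝ), 0 < m → (∀ k, m ≤ ‖f k (-1) y₀‖) →
      ∃ v : ℝ → EuclideanSpace ℝ (Fin 3) → EuclideanSpace ℝ (Fin 3), v 0 = f 0 (-1) ∧
        ContinuousOn (Function.uncurry v) (Set.Ico 0 1 ×ˢ Set.univ) ∧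
        (∀ t ∈ Set.Ico (0 : ℝ) 1, Literature.Analysis.FluidPDE.IsWeaklyDivFree (v t)) ∧
        (∀ s t : ℝ, 0 ≤ s → s < t → t < 1 → ∀ x,
          v t x = Literature.Analysis.FluidPDE.heatFlow (v s) (t - s) x -
            Literature.Analysis.FluidPDE.oseenDuhamel 1 s v v t x) ∧
        (∀ δ : ℝ, 0 < δ → Literature.Analysis.FluidPDE.IsBoundedOn (Set.Icc 0 (1 - δ)) v) ∧
        (∀ K δ : ℝ, 0 < δ → ∃ t ∈ Set.Ico (0 : ℝ) 1, ∃ x : EuclideanSpace ℝ (Fin 3),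
          1 - δ < t ∧ ‖x‖ < δ ∧ K < ‖v t x‖) ∧
        (∀ t ∈ Set.Ico (0 : ℝ) 1, ∀ x, ‖v t x‖ ≤ M / Real.sqrt (1 - t)) :=
  fun _ hc R f hcont M hbdM hdiv hoseen hjump y₀ _ hm hmk =>
    exists_concatenation_of_periodic_slabs_typeI hc R f hcont M hbdM hdiv hoseen hjump y₀ hm hmk

end PumpContinuationEulerProximatePump

end Summit.NavierStokesRegularity.NavierStokesRegularity.Theorems

end
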